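import Mathlib
import Summits.MatrixMultiplication.MatrixMultiplication.Theses.MatrixPointInterpolation
import Summits.MatrixMultiplication.MatrixMultiplication.Theorems.TightWindows.Negative.ShiftCornerMasquerade
import Literature.Algebra.PolynomialIdentities.GenericMatricesGrowth

/-!
# `TightWindows` (stmt-MatrixMultiplication-18939), negative lane: the window at point size `5`
# is LOOSE — `genericWordDim 5 (2(2m+1)) ≥ (m+2)³`

Support file of the refutation `MatrixPointInterpolationTightWindowsRefutation.lean` (crux
disprover): the word functions of length `≤ 2(2m+1)` on `M_5(ℂ)²` contain the `(m+2)³` box-word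
functions `B ↦ B₀^a B₁ B₀^b B₁ B₀^c` (`a, b, c ≤ m + 1`; length `≤ 3m + 5 ≤ 4m + 2` for `m ≥ 3`),
which are linearly independent by the diagonal test of `ShiftCornerMasquerade.lean` (entry `(0,2)`
at `(diag t, U)` is the monomial `t₀^a t₁^b t₂^c`).  Hence the span has dimension `≥ (m+2)³`,
which exceeds `(m+1)³ = n^{2+1}`: the bound of `TightWindows` at `k = 5`, `ε = 1` fails at the
shift / corner masquerade of every size (`box_le_finrank`).
-/

set_option linter.dupNamespace false
-- `MatrixMultiplication.MatrixMultiplication` is the summit/sub-problem path (D-0017)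

namespace Summit.MatrixMultiplication.MatrixMultiplication.Theorems

namespace TightWindowsNeg

open scoped BigOperators

/-! ### Looseness: the window at `k = 5` has dimension `≥ (m+2)³`

The exponent vector `e` of a word is abstracted by its three recursion rules, as in the support
file; the box words are `x^a y x^b y x^c = replicate a 0 ++ 1 :: (replicate b 0 ++ 1 :: replicate c 0)`. -/

/-- Exponent vector after a block of `x`'s. [folklore] -/
theorem expo_replicate_append (e : List (Fin 2) → ℕ →₀ ℕ)
    (hez : ∀ w, e (0 :: w) = Finsupp.single 0 1 + e w) (a : ℕ) (w : List (Fin 2)) :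
    e (List.replicate a 0 ++ w) = Finsupp.single 0 a + e w := by
  induction a with
  | zero => simp
  | succ a ih =>
    rw [List.replicate_succ, List.cons_append, hez, ih, ← add_assoc, ← Finsupp.single_add,
      add_comm 1 a]

/-- Exponent vector of a box word `x^a y x^b y x^c`. [folklore] -/
theorem expo_boxWord (e : List (Fin 2) → ℕ →₀ ℕ) (he0 : e [] = 0)
    (hez : ∀ w, e (0 :: w) = Finsupp.single 0 1 + e w)
    (heo : ∀ w, e (1 :: w) = Finsupp.mapDomain Nat.succ (e w)) (a b c : ℕ) :
    e (List.replicate a 0 ++ (1 :: (List.replicate b 0 ++ (1 :: List.replicate c 0)))) =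
      Finsupp.single 0 a + Finsupp.single 1 b + Finsupp.single 2 c := by
  have hc : e (List.replicate c (0 : Fin 2)) = Finsupp.single 0 c := by
    have h := expo_replicate_append e hez c []
    rwa [List.append_nil, he0, add_zero] at h
  rw [expo_replicate_append e hez, heo, expo_replicate_append e hez, heo, hc]
  simp only [Finsupp.mapDomain_add, Finsupp.mapDomain_single, Nat.succ_eq_add_one, zero_add,
    Nat.reduceAdd]
  abel

/-- A box word has two letters `y`. [folklore] -/
theorem count_boxWord (a b c : ℕ) :
    (List.replicate a (0 : Fin 2) ++ (1 :: (List.replicate b 0 ++ (1 :: List.replicate c 0)))).count 1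
      = 2 := by
  simp [List.count_append, List.count_replicate]

/-- Length of a box word. [folklore] -/
theorem length_boxWord (a b c : ℕ) :
    (List.replicate a (0 : Fin 2) ++ (1 :: (List.replicate b 0 ++ (1 :: List.replicate c 0)))).length
      = a + b + c + 2 := by
  simp only [List.length_append, List.length_replicate, List.length_cons]
  ring

/-- The box-word functions `B ↦ B₀^a B₁ B₀^b B₁ B₀^c` (`a, b, c ≤ m + 1`) on `M_5(ℂ)²` are linearly
independent (diagonal test, entry `(0,2)`). [folklore] -/
theorem linearIndependent_boxFun (e : List (Fin 2) → ℕ →₀ ℕ) (he0 : e [] = 0)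
    (hez : ∀ w, e (0 :: w) = Finsupp.single 0 1 + e w)
    (heo : ∀ w, e (1 :: w) = Finsupp.mapDomain Nat.succ (e w)) (m : ℕ) :
    LinearIndependent ℂ (fun v : Fin (m + 2) × Fin (m + 2) × Fin (m + 2) =>
      (fun B : Fin 2 → Matrix (Fin 5) (Fin 5) ℂ =>
        ((List.replicate (v.1 : ℕ) (0 : Fin 2) ++ (1 :: (List.replicate (v.2.1 : ℕ) 0 ++
          (1 :: List.replicate (v.2.2 : ℕ) 0)))).map B).prod)) := by
  rw [linearIndependent_iff']
  intro s g hsum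
  have key : ∀ t : ℕ → ℂ, ∑ v ∈ s, g v * MvPolynomial.eval t (MvPolynomial.monomial
      (e (List.replicate (v.1 : ℕ) (0 : Fin 2) ++ (1 :: (List.replicate (v.2.1 : ℕ) 0 ++
        (1 :: List.replicate (v.2.2 : ℕ) 0))))) 1) = 0 := by
    intro t
    have h1 := congr_fun hsum ![Matrix.diagonal fun l : Fin 5 => t l,
      fun i j : Fin 5 => if (j : ℕ) = (i : ℕ) + 1 then (1 : ℂ) else 0]
    simp only [Finset.sum_apply, Pi.smul_apply, Pi.zero_apply] at h1
    have h2 := congr_fun (congr_fun h1 0) ⟨2, by norm_num⟩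
    rw [Matrix.sum_apply, Matrix.zero_apply] at h2
    simp only [Matrix.smul_apply, test_prod_apply (fun i j : Fin 5 => if (j : ℕ) = (i : ℕ) + 1
      then (1 : ℂ) else 0) (fun _ _ => rfl) e he0 hez heo, count_boxWord, smul_eq_mul, Fin.val_zero,
      zero_add, if_true] at h2
    exact h2
  have hinj : Set.InjOn (fun v : Fin (m + 2) × Fin (m + 2) × Fin (m + 2) =>
      e (List.replicate (v.1 : ℕ) (0 : Fin 2) ++ (1 :: (List.replicate (v.2.1 : ℕ) 0 ++
        (1 :: List.replicate (v.2.2 : ℕ) 0))))) s := by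
    intro v _ v' _ he
    simp only [expo_boxWord e he0 hez heo] at he
    have e0 := DFunLike.congr_fun he 0
    have e1 := DFunLike.congr_fun he 1
    have e2 := DFunLike.congr_fun he 2
    simp at e0 e1 e2
    exact Prod.ext (Fin.ext e0) (Prod.ext (Fin.ext e1) (Fin.ext e2))
  exact eq_zero_of_eval_eq_zero s g _ hinj key

/-- **The window at `k = 5` is loose**: the span of the word functions of length `≤ 2(2m+1)` on
`M_5(ℂ)²` has dimension `≥ (m+2)³` once `m ≥ 3`. [folklore] -/
theorem box_le_finrank {m : ℕ} (hm : 3 ≤ m) :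
    (m + 2) ^ 3 ≤ Module.finrank ℂ (Submodule.span ℂ
      {f : (Fin 2 → Matrix (Fin 5) (Fin 5) ℂ) → Matrix (Fin 5) (Fin 5) ℂ |
        ∃ w : List (Fin 2), w.length ≤ 2 * (2 * m + 1) ∧ f = fun B => (w.map B).prod}) := by
  haveI := Literature.Algebra.PolynomialIdentities.finite_span_wordMaps 5 (2 * (2 * m + 1))
  have h1 := finrank_span_eq_card (linearIndependent_boxFun
    (List.foldr (fun (x : Fin 2) (f : ℕ →₀ ℕ) =>
      if x = 0 then Finsupp.single 0 1 + f else Finsupp.mapDomain Nat.succ f) 0)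
    rfl (fun v => by simp) (fun v => by simp) m)
  simp only [Fintype.card_prod, Fintype.card_fin] at h1
  have h2 : (m + 2) ^ 3 = (m + 2) * ((m + 2) * (m + 2)) := by ring
  rw [h2, ← h1]
  apply Submodule.finrank_mono
  apply Submodule.span_mono
  rintro f ⟨v, rfl⟩
  refine ⟨_, ?_, rfl⟩
  rw [length_boxWord]
  have := v.1.isLt
  have := v.2.1.isLt
  have := v.2.2.isLt
  omega

end TightWindowsNeg

end Summit.MatrixMultiplication.MatrixMultiplication.Theorems
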